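import Mathlib
import Literature.Probability.LatticeModels.ModifiedSimonInequality
import Literature.Probability.LatticeModels.LoopO1
import HarnessLib
import Literature.Probability.LatticeModels.PairSplitDeletionIdentity

/-!
# PairSplitDeletionIdentity — MOVED (deprecated alias module)

Topic `Literature/Uncategorized`. The pair-split deletion identity of the high-temperature
expansion (`PairSplitDeletionIdentity`, its proof `PairSplitDeletionIdentity_holds` and the 35
helper declarations of the sub-namespace `PairSplitDeletion`), parked here by the gate (accept-time
relocation out of `Summits/CriticalPhenomena/Ising3DConformalLimit/Theorems/StrandShadow/Negative/`
`PairSplitDeletion.lean`, 2026-08-15), now live — all 37 declarations byte-identical — in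
`Literature/Probability/LatticeModels/PairSplitDeletionIdentity.lean` (namespace
`Literature.Probability.LatticeModels`; librarian move p95378, 2026-08-16). This module keeps only
deprecated aliases under the old names, so that its one importer (the `Summits` file above, which
proves `Literature.Uncategorized.PairSplitDeletionIdentity` by
`intro …; exact pairSplit_identity_fin4 G β a`) keeps compiling (re-checked against new module +
aliases: rc 0, deprecation warning only). Provers: import the `Probability/LatticeModels` module
and use the new names; this module can then be deleted.
-/

namespace Literature.Uncategorized

/-- DEPRECATED alias (librarian move 2026-08-16): this constant is, by definition, the moved
`Literature.Probability.LatticeModels.PairSplitDeletionIdentity`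
(statement byte-identical there); kept as a reducible `abbrev` so that files naming the old
constant keep elaborating. [folklore] -/
@[deprecated Literature.Probability.LatticeModels.PairSplitDeletionIdentity (since := "2026-08-16")]
abbrev PairSplitDeletionIdentity : Prop :=
  Literature.Probability.LatticeModels.PairSplitDeletionIdentity

@[deprecated Literature.Probability.LatticeModels.PairSplitDeletion.Rch (since := "2026-08-16")]
alias PairSplitDeletion.Rch := Literature.Probability.LatticeModels.PairSplitDeletion.Rch

@[deprecated Literature.Probability.LatticeModels.PairSplitDeletion.rch_refl
  (since := "2026-08-16")]
alias PairSplitDeletion.rch_refl := Literature.Probability.LatticeModels.PairSplitDeletion.rch_refl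

@[deprecated Literature.Probability.LatticeModels.PairSplitDeletion.rch_mono
  (since := "2026-08-16")]
alias PairSplitDeletion.rch_mono := Literature.Probability.LatticeModels.PairSplitDeletion.rch_mono

@[deprecated Literature.Probability.LatticeModels.PairSplitDeletion.rch_step
  (since := "2026-08-16")]
alias PairSplitDeletion.rch_step := Literature.Probability.LatticeModels.PairSplitDeletion.rch_step

@[deprecated Literature.Probability.LatticeModels.PairSplitDeletion.rch_union_iff
  (since := "2026-08-16")]
alias PairSplitDeletion.rch_union_iff :=
  Literature.Probability.LatticeModels.PairSplitDeletion.rch_union_iff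

@[deprecated Literature.Probability.LatticeModels.PairSplitDeletion.clusterEdges
  (since := "2026-08-16")]
alias PairSplitDeletion.clusterEdges :=
  Literature.Probability.LatticeModels.PairSplitDeletion.clusterEdges

@[deprecated Literature.Probability.LatticeModels.PairSplitDeletion.clusterEdges_subset
  (since := "2026-08-16")]
alias PairSplitDeletion.clusterEdges_subset :=
  Literature.Probability.LatticeModels.PairSplitDeletion.clusterEdges_subset

@[deprecated Literature.Probability.LatticeModels.PairSplitDeletion.sdiff_clusterEdges_avoid
  (since := "2026-08-16")]
alias PairSplitDeletion.sdiff_clusterEdges_avoid :=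
  Literature.Probability.LatticeModels.PairSplitDeletion.sdiff_clusterEdges_avoid

@[deprecated Literature.Probability.LatticeModels.PairSplitDeletion.rch_clusterEdges_iff
  (since := "2026-08-16")]
alias PairSplitDeletion.rch_clusterEdges_iff :=
  Literature.Probability.LatticeModels.PairSplitDeletion.rch_clusterEdges_iff

@[deprecated Literature.Probability.LatticeModels.PairSplitDeletion.clusterEdges_idem
  (since := "2026-08-16")]
alias PairSplitDeletion.clusterEdges_idem :=
  Literature.Probability.LatticeModels.PairSplitDeletion.clusterEdges_idem

@[deprecated Literature.Probability.LatticeModels.PairSplitDeletion.clusterEdges_union_eq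
  (since := "2026-08-16")]
alias PairSplitDeletion.clusterEdges_union_eq :=
  Literature.Probability.LatticeModels.PairSplitDeletion.clusterEdges_union_eq

@[deprecated Literature.Probability.LatticeModels.PairSplitDeletion.rch_of_mem_of_self
  (since := "2026-08-16")]
alias PairSplitDeletion.rch_of_mem_of_self :=
  Literature.Probability.LatticeModels.PairSplitDeletion.rch_of_mem_of_self

@[deprecated Literature.Probability.LatticeModels.PairSplitDeletion.edeg (since := "2026-08-16")]
alias PairSplitDeletion.edeg := Literature.Probability.LatticeModels.PairSplitDeletion.edeg

@[deprecated Literature.Probability.LatticeModels.PairSplitDeletion.edeg_union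
  (since := "2026-08-16")]
alias PairSplitDeletion.edeg_union :=
  Literature.Probability.LatticeModels.PairSplitDeletion.edeg_union

@[deprecated Literature.Probability.LatticeModels.PairSplitDeletion.edeg_eq_zero_of_avoid
  (since := "2026-08-16")]
alias PairSplitDeletion.edeg_eq_zero_of_avoid :=
  Literature.Probability.LatticeModels.PairSplitDeletion.edeg_eq_zero_of_avoid

@[deprecated Literature.Probability.LatticeModels.PairSplitDeletion.edeg_eq_zero_of_not_rch
  (since := "2026-08-16")]
alias PairSplitDeletion.edeg_eq_zero_of_not_rch :=
  Literature.Probability.LatticeModels.PairSplitDeletion.edeg_eq_zero_of_not_rch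

@[deprecated Literature.Probability.LatticeModels.PairSplitDeletion.rch_of_edeg_ne_zero
  (since := "2026-08-16")]
alias PairSplitDeletion.rch_of_edeg_ne_zero :=
  Literature.Probability.LatticeModels.PairSplitDeletion.rch_of_edeg_ne_zero

@[deprecated Literature.Probability.LatticeModels.PairSplitDeletion.disjoint_of_avoid
  (since := "2026-08-16")]
alias PairSplitDeletion.disjoint_of_avoid :=
  Literature.Probability.LatticeModels.PairSplitDeletion.disjoint_of_avoid

@[deprecated Literature.Probability.LatticeModels.PairSplitDeletion.even_card_odd_edeg
  (since := "2026-08-16")]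
alias PairSplitDeletion.even_card_odd_edeg :=
  Literature.Probability.LatticeModels.PairSplitDeletion.even_card_odd_edeg

@[deprecated Literature.Probability.LatticeModels.PairSplitDeletion.dVol (since := "2026-08-16")]
alias PairSplitDeletion.dVol := Literature.Probability.LatticeModels.PairSplitDeletion.dVol

@[deprecated Literature.Probability.LatticeModels.PairSplitDeletion.mem_dVol
  (since := "2026-08-16")]
alias PairSplitDeletion.mem_dVol := Literature.Probability.LatticeModels.PairSplitDeletion.mem_dVol

@[deprecated Literature.Probability.LatticeModels.PairSplitDeletion.dVol_union_eq
  (since := "2026-08-16")]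
alias PairSplitDeletion.dVol_union_eq :=
  Literature.Probability.LatticeModels.PairSplitDeletion.dVol_union_eq

@[deprecated Literature.Probability.LatticeModels.PairSplitDeletion.mem_tJoins_univ
  (since := "2026-08-16")]
alias PairSplitDeletion.mem_tJoins_univ :=
  Literature.Probability.LatticeModels.PairSplitDeletion.mem_tJoins_univ

@[deprecated Literature.Probability.LatticeModels.PairSplitDeletion.fibre_sum
  (since := "2026-08-16")]
alias PairSplitDeletion.fibre_sum :=
  Literature.Probability.LatticeModels.PairSplitDeletion.fibre_sum

@[deprecated Literature.Probability.LatticeModels.PairSplitDeletion.clusterIndex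
  (since := "2026-08-16")]
alias PairSplitDeletion.clusterIndex :=
  Literature.Probability.LatticeModels.PairSplitDeletion.clusterIndex

@[deprecated Literature.Probability.LatticeModels.PairSplitDeletion.mem_clusterIndex
  (since := "2026-08-16")]
alias PairSplitDeletion.mem_clusterIndex :=
  Literature.Probability.LatticeModels.PairSplitDeletion.mem_clusterIndex

@[deprecated Literature.Probability.LatticeModels.PairSplitDeletion.odd_edeg_clusterEdges_iff
  (since := "2026-08-16")]
alias PairSplitDeletion.odd_edeg_clusterEdges_iff :=
  Literature.Probability.LatticeModels.PairSplitDeletion.odd_edeg_clusterEdges_iff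

@[deprecated Literature.Probability.LatticeModels.PairSplitDeletion.edeg_clusterEdges_eq_zero
  (since := "2026-08-16")]
alias PairSplitDeletion.edeg_clusterEdges_eq_zero :=
  Literature.Probability.LatticeModels.PairSplitDeletion.edeg_clusterEdges_eq_zero

@[deprecated Literature.Probability.LatticeModels.PairSplitDeletion.rch_a1 (since := "2026-08-16")]
alias PairSplitDeletion.rch_a1 := Literature.Probability.LatticeModels.PairSplitDeletion.rch_a1

@[deprecated Literature.Probability.LatticeModels.PairSplitDeletion.clusterEdges_mem_clusterIndex
  (since := "2026-08-16")]
alias PairSplitDeletion.clusterEdges_mem_clusterIndex :=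
  Literature.Probability.LatticeModels.PairSplitDeletion.clusterEdges_mem_clusterIndex

@[deprecated Literature.Probability.LatticeModels.PairSplitDeletion.sum_clean_eq_sum_fibres
  (since := "2026-08-16")]
alias PairSplitDeletion.sum_clean_eq_sum_fibres :=
  Literature.Probability.LatticeModels.PairSplitDeletion.sum_clean_eq_sum_fibres

@[deprecated Literature.Probability.LatticeModels.PairSplitDeletion.fibre_pair_side
  (since := "2026-08-16")]
alias PairSplitDeletion.fibre_pair_side :=
  Literature.Probability.LatticeModels.PairSplitDeletion.fibre_pair_side

@[deprecated Literature.Probability.LatticeModels.PairSplitDeletion.fibre_four_side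
  (since := "2026-08-16")]
alias PairSplitDeletion.fibre_four_side :=
  Literature.Probability.LatticeModels.PairSplitDeletion.fibre_four_side

@[deprecated Literature.Probability.LatticeModels.PairSplitDeletion.pairSplit_identity
  (since := "2026-08-16")]
alias PairSplitDeletion.pairSplit_identity :=
  Literature.Probability.LatticeModels.PairSplitDeletion.pairSplit_identity

@[deprecated Literature.Probability.LatticeModels.PairSplitDeletion.pairSplit_identity_fin4
  (since := "2026-08-16")]
alias PairSplitDeletion.pairSplit_identity_fin4 :=
  Literature.Probability.LatticeModels.PairSplitDeletion.pairSplit_identity_fin4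

@[deprecated Literature.Probability.LatticeModels.PairSplitDeletionIdentity_holds
  (since := "2026-08-16")]
alias PairSplitDeletionIdentity_holds :=
  Literature.Probability.LatticeModels.PairSplitDeletionIdentity_holds

end Literature.Uncategorized
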